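import Mathlib
import Literature.AlgebraicGeometry.Resolution.BlowupPrincipalCharts
import Literature.AlgebraicGeometry.Resolution.BlowupLiftsCongruence
import Literature.AlgebraicGeometry.Resolution.AffineBlowupAlgebra
import Summits.ResolutionOfSingularities.ResolutionOfSingularities.Theorems.WildQuotientsWildQuotientResolutionToricExitChartASections
import Summits.ResolutionOfSingularities.ResolutionOfSingularities.Theorems.WildQuotientsWildQuotientResolutionJordanFourRootCharts

/-!
# V4U piece 0, ring brick `H₀` (1/3): the sections of `Bl_{I₆} 𝔸ⁿ` over the `μ₃` vertex chart, and the root-chart automorphism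

(crux stmt-ResolutionOfSingularities-15640 `WildQuotients.WildQuotientResolution`, line `Sketch`,
sector `|G| = p`; programme V4U of `L/w45c/CHAIN.md` v7.5 §4, RULING v7.5 / CORRECTION
2026-08-27T06:30:44Z «H₀ (μ₃ ring brick) = res-type-087»: the `H` hypothesis of lead-1's
`BlowupExit.exists_isBlowup_regular_of_vertexPresentation` (p505172) at
«`u := ι₀(x_a²)`, `κ := {j ≠ 0}`, `y j := ι₀ (I₆ j)`, `F₀ := {X a, X b, X c}`, `O := O₀`».
[OURS · L1 W4.5c] — NOT a statement of any manuscript; replaces the role of no printed item.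
Prover res-type-087.)

This file is the CHART-RING half (no group action on the scheme yet), in the pattern of
res-L1-w45c-stub-3's `ToricExit.exists_ringEquiv_blowupChart_adjoin` (…ToricExitChartASections, J₃):

* `JordanFour.exists_rootChart4Equiv` — THE root-chart automorphism `σ_U` of `k[x]` for the `μ₃`
  vertex chart of `J₄` exists: `X b ↦ X b + X a`, `X c ↦ X c + X a·X b`, `X d ↦ X d + X a·X c`,
  `X i ↦ X i` otherwise (explicit inverse; 4-variable sibling of `ToricExit.exists_rootChartEquiv`).
* `JordanFour.aeval_root0_comp_eq` — the root substitution `ψ₀` (`x_a ↦ ρ³`, `x_b ↦ βρ²`,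
  `x_c ↦ γρ`, rest fixed; slots `ρ = X a`, `β = X b`, `γ = X c`) intertwines the `J₄` automorphism
  `σ` (given by its law) with `σ_U`: `ψ₀ ∘ σ = σ_U ∘ ψ₀`.
* `JordanFour.aeval_root0_I6` — `ψ₀(g_j) = q_j · ρ⁶` for the eight generators `g_j` of `I₆` and the
  chart quotients `q_j` of `JordanFour.chart0_ringEquiv_adjoin` (p490009).
* `JordanFour.exists_ringEquiv_blowupChart0_adjoin` — **`Γ(V, V[x_a²]) ≅ S₀ = k[ψ₀(x), q]`** for
  `V = Bl_{I₆} 𝔸ⁿ` and its intrinsic principal chart `V[x_a²] = blowupChart π Ĩ₆ ⊤ (ι₀ x_a²)`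
  (Literature `BlowupPrincipalCharts`), carrying `π^* f ↦ ψ₀ f` AND every chart ratio `T_j`
  (`π^*g_j = π^*x_a² · T_j`) to `q_j`: the chain `Γ(V, V[x_a²]) ≅ Γ(𝔸ⁿ,⊤)[Ĩ₆(⊤)/x_a²]`
  (`IsBlowup.exists_ringEquiv_blowupChart`) `≅ k[x][I₆/x_a²]` (transport along `ΓSpecIso`,
  `ToricExit.exists_blowupAlgebra_ringEquiv_of_ringEquiv`) `≅ (k[x][I₆t])_{(x_a² t)}`
  (`reesChartEquiv`) `≅ S₀` (p490009); the ratios by cancelling `ρ⁶` in the domain `k[x]`.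
-/

-- single-problem summit: the doubled namespace component `ResolutionOfSingularities` is forced
set_option linter.dupNamespace false

noncomputable section

open CategoryTheory AlgebraicGeometry TopologicalSpace MvPolynomial
open Literature.AlgebraicGeometry.Resolution

namespace Summit.ResolutionOfSingularities.ResolutionOfSingularities.Theorems.WildQuotientResolution.JordanFour

/-! ## The root-chart automorphism `σ_U` of the `μ₃` vertex chart -/

/-- **The root-chart automorphism exists** (`μ₃` vertex chart of `J₄`): a `k`-algebra automorphism
`σ_U` of `k[x]` with `σ_U x_b = x_b + x_a`, `σ_U x_c = x_c + x_a x_b`, `σ_U x_d = x_d + x_a x_c`,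
`σ_U xᵢ = xᵢ` otherwise (inverse `x_b ↦ x_b − x_a`, `x_c ↦ x_c − x_a x_b + x_a²`,
`x_d ↦ x_d − x_a x_c + x_a² x_b − x_a³`). [OURS · L1 W4.5c] [folklore] -/
theorem exists_rootChart4Equiv (k : Type) [Field k] (n : ℕ) (a b c d : Fin n)
    (hab : a ≠ b) (hac : a ≠ c) (had : a ≠ d) (hbc : b ≠ c) (hbd : b ≠ d) (hcd : c ≠ d) :
    ∃ σU : MvPolynomial (Fin n) k ≃ₐ[k] MvPolynomial (Fin n) k,
      σU (X b) = X b + X a ∧ σU (X c) = X c + X a * X b ∧ σU (X d) = X d + X a * X c ∧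
        ∀ i, i ≠ b → i ≠ c → i ≠ d → σU (X i) = X i := by
  classical
  let φ : MvPolynomial (Fin n) k →ₐ[k] MvPolynomial (Fin n) k :=
    aeval fun i => if i = b then X b + X a else if i = c then X c + X a * X b
      else if i = d then X d + X a * X c else X i
  let φ' : MvPolynomial (Fin n) k →ₐ[k] MvPolynomial (Fin n) k :=
    aeval fun i => if i = b then X b - X a else if i = c then X c - X a * X b + X a ^ 2
      else if i = d then X d - X a * X c + X a ^ 2 * X b - X a ^ 3 else X i
  have hφb : φ (X b) = X b + X a := by
    change aeval _ (X b) = _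
    rw [aeval_X, if_pos rfl]
  have hφc : φ (X c) = X c + X a * X b := by
    change aeval _ (X c) = _
    rw [aeval_X, if_neg (Ne.symm hbc), if_pos rfl]
  have hφd : φ (X d) = X d + X a * X c := by
    change aeval _ (X d) = _
    rw [aeval_X, if_neg (Ne.symm hbd), if_neg (Ne.symm hcd), if_pos rfl]
  have hφi : ∀ i, i ≠ b → i ≠ c → i ≠ d → φ (X i) = X i := by
    intro i hib hic hid
    change aeval _ (X i) = _
    rw [aeval_X, if_neg hib, if_neg hic, if_neg hid]
  have hφ'b : φ' (X b) = X b - X a := by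
    change aeval _ (X b) = _
    rw [aeval_X, if_pos rfl]
  have hφ'c : φ' (X c) = X c - X a * X b + X a ^ 2 := by
    change aeval _ (X c) = _
    rw [aeval_X, if_neg (Ne.symm hbc), if_pos rfl]
  have hφ'd : φ' (X d) = X d - X a * X c + X a ^ 2 * X b - X a ^ 3 := by
    change aeval _ (X d) = _
    rw [aeval_X, if_neg (Ne.symm hbd), if_neg (Ne.symm hcd), if_pos rfl]
  have hφ'i : ∀ i, i ≠ b → i ≠ c → i ≠ d → φ' (X i) = X i := by
    intro i hib hic hid
    change aeval _ (X i) = _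
    rw [aeval_X, if_neg hib, if_neg hic, if_neg hid]
  have hφa : φ (X a) = X a := hφi a hab hac had
  have hφ'a : φ' (X a) = X a := hφ'i a hab hac had
  have h1 : φ.comp φ' = AlgHom.id k _ := by
    refine MvPolynomial.algHom_ext fun i => ?_
    change φ (φ' (X i)) = X i
    by_cases hib : i = b
    · subst hib
      rw [hφ'b, map_sub, hφb, hφa]; ring
    by_cases hic : i = c
    · subst hic
      rw [hφ'c, map_add, map_sub, map_mul, map_pow, hφc, hφa, hφb]; ring
    by_cases hid : i = d
    · subst hid
      rw [hφ'd, map_sub, map_add, map_sub, map_mul, map_mul, map_pow, map_pow, hφd, hφa, hφc, hφb]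
      ring
    · rw [hφ'i i hib hic hid, hφi i hib hic hid]
  have h2 : φ'.comp φ = AlgHom.id k _ := by
    refine MvPolynomial.algHom_ext fun i => ?_
    change φ' (φ (X i)) = X i
    by_cases hib : i = b
    · subst hib
      rw [hφb, map_add, hφ'b, hφ'a]; ring
    by_cases hic : i = c
    · subst hic
      rw [hφc, map_add, map_mul, hφ'c, hφ'a, hφ'b]; ring
    by_cases hid : i = d
    · subst hid
      rw [hφd, map_add, map_mul, hφ'd, hφ'a, hφ'c]; ring
    · rw [hφi i hib hic hid, hφ'i i hib hic hid]
  exact ⟨AlgEquiv.ofAlgHom φ φ' h1 h2, hφb, hφc, hφd, hφi⟩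

/-! ## The root substitution `ψ₀` of the `μ₃` vertex chart -/

section Root

variable (k : Type) [Field k] (n : ℕ) (a b c d : Fin n)

/-- The eight generators `x_a², x_ax_b², x_ax_bx_c, x_ax_c³, x_b³, x_b²x_c², x_bx_c⁴, x_c⁶` of `I₆`
(vector literal of record, p490963 / p501160). -/
local notation3 "g8" => (![X a ^ 2, X a * X b ^ 2, X a * X b * X c, X a * X c ^ 3, X b ^ 3,
  X b ^ 2 * X c ^ 2, X b * X c ^ 4, X c ^ 6] : Fin 8 → MvPolynomial (Fin n) k)

/-- The chart quotients `q_j = ψ₀(g_j)/ρ⁶` of record (`JordanFour.chart0_ringEquiv_adjoin`). -/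
local notation3 "q8" => (![1, X a * X b ^ 2, X b * X c, X c ^ 3, X b ^ 3, X b ^ 2 * X c ^ 2,
  X b * X c ^ 4, X c ^ 6] : Fin 8 → MvPolynomial (Fin n) k)

/-- The root substitution of record `ψ₀`: `x_a ↦ ρ³`, `x_b ↦ β ρ²`, `x_c ↦ γ ρ`, `x_s ↦ x_s · ρ⁰`
(`JordanFour.chart0_ringEquiv_adjoin`). -/
local notation3 "root0" => (fun s : Fin n => (if s = a then X a ^ 3 else
  X s * X a ^ (if s = b then 2 else if s = c then 1 else 0) : MvPolynomial (Fin n) k))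

/-- `ψ₀(x_a) = ρ³`. [folklore] -/
theorem aeval_root0_X_a : MvPolynomial.aeval root0 (X a : MvPolynomial (Fin n) k) = X a ^ 3 := by
  rw [aeval_X, if_pos rfl]

/-- `ψ₀(x_b) = β ρ²` (`a ≠ b`). [folklore] -/
theorem aeval_root0_X_b (hab : a ≠ b) :
    MvPolynomial.aeval root0 (X b : MvPolynomial (Fin n) k) = X b * X a ^ 2 := by
  rw [aeval_X, if_neg (Ne.symm hab), if_pos rfl]

/-- `ψ₀(x_c) = γ ρ` (`a ≠ c`, `b ≠ c`). [folklore] -/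
theorem aeval_root0_X_c (hac : a ≠ c) (hbc : b ≠ c) :
    MvPolynomial.aeval root0 (X c : MvPolynomial (Fin n) k) = X c * X a := by
  rw [aeval_X, if_neg (Ne.symm hac), if_neg (Ne.symm hbc), if_pos rfl, pow_one]

/-- `ψ₀(x_i) = x_i` for `i ∉ {a, b, c}`. [folklore] -/
theorem aeval_root0_X_of_ne (i : Fin n) (hia : i ≠ a) (hib : i ≠ b) (hic : i ≠ c) :
    MvPolynomial.aeval root0 (X i : MvPolynomial (Fin n) k) = X i := by
  rw [aeval_X, if_neg hia, if_neg hib, if_neg hic, pow_zero, mul_one]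

/-- **`ψ₀ ∘ σ = σ_U ∘ ψ₀`**: the root substitution intertwines the `J₄` automorphism `σ`
(`x_b ↦ x_b + x_a`, `x_c ↦ x_c + x_b`, `x_d ↦ x_d + x_c`, rest fixed) with the root-chart
automorphism `σ_U` (`β ↦ β + ρ`, `γ ↦ γ + ρβ`, `x_d ↦ x_d + ργ`, rest fixed); both given by their
laws. [OURS · L1 W4.5c] [folklore] -/
theorem aeval_root0_comp_eq (hab : a ≠ b) (hac : a ≠ c) (had : a ≠ d) (hbc : b ≠ c) (hbd : b ≠ d)
    (hcd : c ≠ d)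
    (σ σU : MvPolynomial (Fin n) k ≃ₐ[k] MvPolynomial (Fin n) k)
    (hb : σ (X b) = X b + X a) (hc : σ (X c) = X c + X b) (hd : σ (X d) = X d + X c)
    (hσ : ∀ i, i ≠ b → i ≠ c → i ≠ d → σ (X i) = X i)
    (hUb : σU (X b) = X b + X a) (hUc : σU (X c) = X c + X a * X b) (hUd : σU (X d) = X d + X a * X c)
    (hσU : ∀ i, i ≠ b → i ≠ c → i ≠ d → σU (X i) = X i) :
    (MvPolynomial.aeval root0).comp (σ : MvPolynomial (Fin n) k →ₐ[k] MvPolynomial (Fin n) k) =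
      (σU : MvPolynomial (Fin n) k →ₐ[k] MvPolynomial (Fin n) k).comp (MvPolynomial.aeval root0) := by
  have ha : σ (X a) = X a := hσ a hab hac had
  have hUa : σU (X a) = X a := hσU a hab hac had
  refine MvPolynomial.algHom_ext fun i => ?_
  simp only [AlgHom.comp_apply, AlgEquiv.coe_toAlgHom]
  by_cases hib : i = b
  · rw [hib, hb, map_add, aeval_root0_X_b k n a b c hab, aeval_root0_X_a, map_mul, map_pow, hUb, hUa]
    ring
  by_cases hic : i = c
  · rw [hic, hc, map_add, aeval_root0_X_c k n a b c hac hbc, aeval_root0_X_b k n a b c hab, map_mul,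
      hUc, hUa]
    ring
  by_cases hid : i = d
  · rw [hid, hd, map_add, aeval_root0_X_of_ne k n a b c d (Ne.symm had) (Ne.symm hbd) (Ne.symm hcd),
      aeval_root0_X_c k n a b c hac hbc, hUd]
    ring
  · by_cases hia : i = a
    · rw [hia, ha, aeval_root0_X_a, map_pow, hUa]
    · rw [hσ i hib hic hid, aeval_root0_X_of_ne k n a b c i hia hib hic, hσU i hib hic hid]

/-- **`ψ₀(g_j) = q_j · ρ⁶`** for the generators of `I₆` and the chart quotients of record.
[OURS · L1 W4.5c] [folklore] -/
theorem aeval_root0_I6 (hab : a ≠ b) (hbc : b ≠ c) (hac : a ≠ c) (j : Fin 8) :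
    MvPolynomial.aeval root0 (g8 j) = q8 j * X a ^ 6 := by
  have hψa := aeval_root0_X_a k n a b c
  have hψb := aeval_root0_X_b k n a b c hab
  have hψc := aeval_root0_X_c k n a b c hac hbc
  fin_cases j
  · change MvPolynomial.aeval root0 (X a ^ 2) = 1 * _
    rw [map_pow, hψa]; ring
  · change MvPolynomial.aeval root0 (X a * X b ^ 2) = X a * X b ^ 2 * _
    rw [map_mul, map_pow, hψa, hψb]; ring
  · change MvPolynomial.aeval root0 (X a * X b * X c) = X b * X c * _
    rw [map_mul, map_mul, hψa, hψb, hψc]; ring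
  · change MvPolynomial.aeval root0 (X a * X c ^ 3) = X c ^ 3 * _
    rw [map_mul, map_pow, hψa, hψc]; ring
  · change MvPolynomial.aeval root0 (X b ^ 3) = X b ^ 3 * _
    rw [map_pow, hψb]; ring
  · change MvPolynomial.aeval root0 (X b ^ 2 * X c ^ 2) = X b ^ 2 * X c ^ 2 * _
    rw [map_mul, map_pow, map_pow, hψb, hψc]; ring
  · change MvPolynomial.aeval root0 (X b * X c ^ 4) = X b * X c ^ 4 * _
    rw [map_mul, map_pow, hψb, hψc]; ring
  · change MvPolynomial.aeval root0 (X c ^ 6) = X c ^ 6 * _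
    rw [map_pow, hψc]; ring

/-! ## `Γ(V, V[x_a²]) ≅ S₀` with `π^* ↦ ψ₀` and `T_j ↦ q_j` -/

/-- The ideal `I₆`. -/
local notation3 "I6" => Ideal.span (Set.range g8)
/-- `Γ(Spec k[x], ⊤) ← k[x]`. -/
local notation3 "ι₀" => (Scheme.ΓSpecIso (CommRingCat.of (MvPolynomial (Fin n) k))).inv.hom
/-- The intrinsic principal chart `V[x_a²]` of `V = Bl_{I₆} 𝔸ⁿ`. -/
local notation3 "Vu" => blowupChart (affineBlowup.π I6) (affineBlowup.idealSheaf I6)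
  ⟨⊤, isAffineOpen_top _⟩ (ι₀ (X a ^ 2))
/-- `V[x_a²] ≤ π⁻¹ ⊤`. -/
local notation3 "hVu" => blowupChart_le_preimage (affineBlowup.π I6) (affineBlowup.idealSheaf I6)
  ⟨⊤, isAffineOpen_top _⟩ (ι₀ (X a ^ 2))
/-- The chart-`0` subring `S₀ = k[ψ₀(x), q] ⊆ k[x]` of record (p490009, stub-1's B0-b files). -/
local notation3 "S₀" => Algebra.adjoin k
  (Set.range (fun s : Fin n => MvPolynomial.aeval root0 (X s : MvPolynomial (Fin n) k)) ∪
    Set.range q8)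

set_option maxHeartbeats 3200000 in
-- the chart terms are large: elaboration of the statement alone exceeds 8·10⁵ heartbeats
/-- **`Γ(V, V[x_a²]) ≅ S₀` with `π^* f ↦ ψ₀ f` and `T_j ↦ q_j`** for `V = Bl_{I₆} 𝔸ⁿ` and its
intrinsic principal chart at `x_a²` (the chain in the module docstring). [OURS · L1 W4.5c]
[folklore; assembly of landed decls] -/
theorem exists_ringEquiv_blowupChart0_adjoin (hab : a ≠ b) (hbc : b ≠ c) (hac : a ≠ c) :
    ∃ Θ : Γ(affineBlowup I6, Vu) ≃+* ↥S₀,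
      (∀ f : MvPolynomial (Fin n) k,
        ((Θ ((affineBlowup.π I6).appLE ⊤ Vu hVu (ι₀ f)) : ↥S₀) : MvPolynomial (Fin n) k) =
          MvPolynomial.aeval root0 f) ∧
      ∀ (j : Fin 8) (T : Γ(affineBlowup I6, Vu)),
        (affineBlowup.π I6).appLE ⊤ Vu hVu (ι₀ (g8 j)) =
          (affineBlowup.π I6).appLE ⊤ Vu hVu (ι₀ (X a ^ 2)) * T →
        ((Θ T : ↥S₀) : MvPolynomial (Fin n) k) = q8 j := by
  classical
  let S : Type := MvPolynomial (Fin n) k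
  have hπ : IsBlowup (affineBlowup.π I6) (affineBlowup.idealSheaf I6) := affineBlowup.isBlowup I6
  let θ : Γ(Spec (CommRingCat.of S), ⊤) ≃+* S :=
    (Scheme.ΓSpecIso (CommRingCat.of S)).commRingCatIsoToRingEquiv
  have hθ : ∀ f : S, θ (ι₀ f) = f := fun f => by
    change ((Scheme.ΓSpecIso (CommRingCat.of S)).inv ≫ (Scheme.ΓSpecIso (CommRingCat.of S)).hom) f = f
    rw [Iso.inv_hom_id]; rfl
  have hIdeal : (affineBlowup.idealSheaf I6).ideal ⟨⊤, isAffineOpen_top _⟩ = (I6).map ι₀ := by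
    change (Scheme.IdealSheafData.ofIdealTop _).ideal ⟨⊤, isAffineOpen_top _⟩ = _
    rw [ideal_ofIdealTop_top]
  have hxa : ι₀ (X a ^ 2) ∈ (affineBlowup.idealSheaf I6).ideal ⟨⊤, isAffineOpen_top _⟩ := by
    rw [hIdeal]; exact Ideal.mem_map_of_mem _ (Ideal.subset_span ⟨0, rfl⟩)
  -- (1) `Γ(V, V[x_a²]) ≅ Γ(𝔸ⁿ, ⊤)[Ĩ₆(⊤) / x_a²]`
  obtain ⟨e₁, he₁⟩ := hπ.exists_ringEquiv_blowupChart ⟨⊤, isAffineOpen_top _⟩ hxa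
  -- (2) transport along `Γ(𝔸ⁿ, ⊤) ≅ k[x]`
  have hJ' : (I6) = ((affineBlowup.idealSheaf I6).ideal ⟨⊤, isAffineOpen_top _⟩).map
      (θ : Γ(Spec (CommRingCat.of S), ⊤) →+* S) := by
    rw [hIdeal, Ideal.map_map]
    have hcomp : (θ : Γ(Spec (CommRingCat.of S), ⊤) →+* S).comp ι₀ = RingHom.id S :=
      RingHom.ext fun f => hθ f
    rw [hcomp, Ideal.map_id]
  have ha' : (X a ^ 2 : S) = θ (ι₀ (X a ^ 2)) := (hθ (X a ^ 2)).symm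
  obtain ⟨e₂, he₂⟩ := ToricExit.exists_blowupAlgebra_ringEquiv_of_ringEquiv θ
    ((affineBlowup.idealSheaf I6).ideal ⟨⊤, isAffineOpen_top _⟩) (ι₀ (X a ^ 2)) (I6) hJ'
    (X a ^ 2) ha'
  -- (3) `k[x][I₆/x_a²] ≅ (k[x][I₆t])_{(x_a² t)}` and (4) p490009
  let e₃ : blowupAlgebra (I6) (X a ^ 2) ≃+* chartRing g8 0 :=
    (reesChartEquiv (g8 0) (Ideal.mem_span_range_self (f := g8) (x := 0))).symm
  have he₃ : ∀ f : S, e₃ (algebraMap S (blowupAlgebra (I6) (X a ^ 2)) f) = chartBase g8 0 f := by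
    intro f
    apply (reesChartEquiv (g8 0) (Ideal.mem_span_range_self (f := g8) (x := 0))).injective
    change (reesChartEquiv (g8 0) _) ((reesChartEquiv (g8 0) _).symm _) = _
    rw [RingEquiv.apply_symm_apply, reesChartEquiv_reesChartBase]
    rfl
  obtain ⟨e₄, he₄, -⟩ := chart0_ringEquiv_adjoin k n a b c hab hbc hac
  have hbase : ∀ f : S, (((e₁.trans (e₂.trans (e₃.trans e₄)))
      ((affineBlowup.π I6).appLE ⊤ Vu hVu (ι₀ f)) : ↥S₀) : S) = MvPolynomial.aeval root0 f := by
    intro f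
    change ((e₄ (e₃ (e₂ (e₁ _))) : ↥S₀) : S) = _
    rw [he₁, he₂, hθ, he₃]
    exact he₄ f
  refine ⟨e₁.trans (e₂.trans (e₃.trans e₄)), hbase, fun j T hT => ?_⟩
  -- the ratios: `ψ₀(g_j) = ψ₀(x_a²) · Θ(T_j)` in the domain `k[x]`, and `ψ₀(g_j) = q_j ρ⁶`
  have h1 := congrArg (fun z => (((e₁.trans (e₂.trans (e₃.trans e₄))) z : ↥S₀) : S)) hT
  simp only [map_mul, Subalgebra.coe_mul] at h1
  rw [hbase, hbase, aeval_root0_I6 k n a b c hab hbc hac, map_pow, aeval_root0_X_a, ← pow_mul]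
    at h1
  norm_num at h1
  rw [mul_comm] at h1
  exact (mul_left_cancel₀ (pow_ne_zero 6 (X_ne_zero a)) h1).symm

end Root

end Summit.ResolutionOfSingularities.ResolutionOfSingularities.Theorems.WildQuotientResolution.JordanFour

end
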